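import Summits.Langlands.Langlands.Theorems.MonomialConverseAbelianFreeBrauerSpan

/-!
# Abelian-free Brauer induction, II: linear characters, the linear part, coverers and hulls

Part of the sorry-free proof of the crux `Summit.Langlands.Langlands.Theses.MonomialConverse.AbelianFreeBrauer`
(item stmt-Langlands-18580, route-Langlands-MonomialConverse), split over the files
`MonomialConverseAbelianFreeBrauer{Span, Linear, Moves, Hubs, Affine, Expansion, Proof}` (landing
order; all definitions live in `Span`, the last file holds `abelianFreeBrauer_proof` and the proof
outline).  Everything is over the in-tree class-function library
`Literature.RepresentationTheory.FiniteGroups` (`indClassFun`, `classInner`, `virtChars`, `IsIrrChar`);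
no `sorry`, no new axioms, no `Prop`-valued definitions (predicates are sets).

Contents: the calculus of `linF G` (`mem_linF : χ ∈ linF G ↔ IsIrrChar G χ ∧ χ 1 = 1`,
`exists_hom_of_mem_linF`, products, inflation), of the linear part `linPart` (additivity, idempotence
on the span of `linF`, vanishing on `linOrth` and on `J`), `sub_linPart_mem_afSpan`; Frobenius values
`⟨π_K, μ⟩ = [K ≤ ker μ]` (`classInner_indOne_coe`) and `⟨π_K μ, μ'⟩`, `linPart (π_K μ)` for covering
`K`; `coverers` (`mem_coverers_of_le`, `top_mem_coverers`) and the hull (normal, contains `K` and `G'`,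
`hull_le_ker`, `hull_eq_top_iff : hull G K = ⊤ ↔ K ∈ coverers G`, `hull_absorbs`).

References: Serre (`SerreLinearRepresentations1977`) §7.2; Isaacs (`Isaacs1976`) Ch. 5.
-/

set_option linter.dupNamespace false

noncomputable section

open scoped BigOperators Pointwise

namespace Summit.Langlands.Langlands.Theorems.AbelianFreeBrauer

open Literature.RepresentationTheory.FiniteGroups

variable {G : Type} [Group G]

/-! ### Linear characters as functions and the linear part -/

section Linear

variable [Fintype G]

/-- Membership in `linF`. [folklore] -/
theorem mem_linF {χ : G → ℂ} : χ ∈ linF G ↔ IsIrrChar G χ ∧ χ 1 = 1 := by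
  rw [linF, Finset.mem_filter, Set.Finite.mem_toFinset]
  rfl

/-- Linear characters `G →* ℂˣ` give members of `linF`. [folklore] -/
theorem coe_mem_linF (μ : G →* ℂˣ) : (fun g => (μ g : ℂ)) ∈ linF G :=
  mem_linF.mpr ⟨isIrrChar_coe μ, by simp only [map_one, Units.val_one]⟩

/-- Members of `linF` come from homomorphisms `G →* ℂˣ`. [folklore] -/
theorem exists_hom_of_mem_linF {χ : G → ℂ} (h : χ ∈ linF G) :
    ∃ μ : G →* ℂˣ, (fun g => (μ g : ℂ)) = χ :=
  (mem_linF.mp h).1.exists_monoidHom_of_apply_one (mem_linF.mp h).2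

/-- Members of `linF` are virtual characters. [folklore] -/
theorem mem_virtChars_of_mem_linF {χ : G → ℂ} (h : χ ∈ linF G) : χ ∈ virtChars G :=
  (mem_linF.mp h).1.mem_virtChars

/-- **Orthonormality of linear characters.** [folklore] -/
theorem classInner_linF {χ χ' : G → ℂ} (hχ : χ ∈ linF G) (hχ' : χ' ∈ linF G) :
    classInner χ χ' = if χ = χ' then 1 else 0 :=
  (mem_linF.mp hχ).1.classInner_eq (mem_linF.mp hχ').1

/-- `1 ∈ linF`. [folklore] -/
theorem one_mem_linF : (1 : G → ℂ) ∈ linF G := by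
  have h := coe_mem_linF (1 : G →* ℂˣ)
  simp only [MonoidHom.one_apply, Units.val_one] at h
  exact h

/-- `linF` is closed under products. [folklore] -/
theorem mul_mem_linF {χ χ' : G → ℂ} (hχ : χ ∈ linF G) (hχ' : χ' ∈ linF G) : χ * χ' ∈ linF G := by
  obtain ⟨μ, rfl⟩ := exists_hom_of_mem_linF hχ
  obtain ⟨ν, rfl⟩ := exists_hom_of_mem_linF hχ'
  have h := coe_mem_linF (μ * ν)
  simp only [MonoidHom.mul_apply, Units.val_mul] at h
  exact h

/-- `J(G) ⊥ linF`. [folklore] -/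
theorem classInner_eq_zero_of_mem_afSpan {f χ : G → ℂ} (hf : f ∈ afSpan G) (hχ : χ ∈ linF G) :
    classInner f χ = 0 := by
  obtain ⟨μ, rfl⟩ := exists_hom_of_mem_linF hχ
  exact classInner_coe_eq_zero_of_mem_afSpan hf μ


/-- Inflations `β ∘ π` of irreducible characters of a commutative quotient are linear. [folklore] -/
theorem comp_mk_mem_linF (T : Subgroup G) [T.Normal] (hc : IsMulCommutative (G ⧸ T)) {β : G ⧸ T → ℂ}
    (hβ : β ∈ (irrChars_finite_holds (G ⧸ T)).toFinset) :
    (β ∘ (QuotientGroup.mk : G → G ⧸ T)) ∈ linF G := by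
  haveI := hc
  have hβ' : IsIrrChar (G ⧸ T) β := (irrChars_finite_holds (G ⧸ T)).mem_toFinset.mp hβ
  refine mem_linF.mpr ⟨hβ'.comp_quotientMk, ?_⟩
  rw [Function.comp_apply, QuotientGroup.mk_one]
  exact hβ'.map_one

/-- For `T` normal with commutative quotient and `μ` linear: `π_T · μ` lies in the `ℂ`-span of the linear
characters. [folklore] -/
theorem indOne_mul_mem_span (T : Subgroup G) [T.Normal] (hc : IsMulCommutative (G ⧸ T)) {χ : G → ℂ}
    (hχ : χ ∈ linF G) : indOne T * χ ∈ Submodule.span ℂ (linF G : Set (G → ℂ)) := by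
  rw [indOne_eq_sum_comp_mk T hc, Finset.sum_mul]
  exact Submodule.sum_mem _ fun β hβ =>
    Submodule.subset_span (mul_mem_linF (comp_mk_mem_linF T hc hβ) hχ)

/-- `⟨linPart f, χ⟩ = ⟨f, χ⟩` for `χ` linear. [folklore] -/
theorem classInner_linPart (f : G → ℂ) {χ' : G → ℂ} (hχ' : χ' ∈ linF G) :
    classInner (linPart G f) χ' = classInner f χ' := by
  rw [linPart, classInner_sum_left]
  have h : ∀ χ ∈ linF G, classInner (classInner f χ • χ) χ' =
      if χ = χ' then classInner f χ' else 0 := fun χ hχ => by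
    rw [classInner_smul_left, classInner_linF hχ hχ']
    split_ifs with h
    · rw [h, mul_one]
    · rw [mul_zero]
  rw [Finset.sum_congr rfl h, Finset.sum_ite_eq' (linF G) χ', if_pos hχ']

/-- `f - linPart f ⊥ linF`. [folklore] -/
theorem classInner_sub_linPart (f : G → ℂ) {χ : G → ℂ} (hχ : χ ∈ linF G) :
    classInner (f - linPart G f) χ = 0 := by
  rw [sub_eq_add_neg, classInner_add_left, ← neg_one_smul ℂ (linPart G f), classInner_smul_left,
    classInner_linPart f hχ]
  ring

/-- `linPart f ∈ R(G)` for `f ∈ R(G)` (the coefficients `⟨f, χ⟩` are integers). [folklore] -/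
theorem linPart_mem_virtChars {f : G → ℂ} (hf : f ∈ virtChars G) : linPart G f ∈ virtChars G := by
  refine Subring.sum_mem _ fun χ hχ => ?_
  obtain ⟨n, hn⟩ := exists_int_classInner_of_mem_virtChars hf (mem_linF.mp hχ).1
  rw [hn, Int.cast_smul_eq_zsmul]
  exact Subring.zsmul_mem _ (mem_virtChars_of_mem_linF hχ) n

/-- `linPart` is additive. [folklore] -/
theorem linPart_add (f g : G → ℂ) : linPart G (f + g) = linPart G f + linPart G g := by
  simp only [linPart, classInner_add_left, add_smul, Finset.sum_add_distrib]

/-- `linPart` is homogeneous. [folklore] -/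
theorem linPart_smul (c : ℂ) (f : G → ℂ) : linPart G (c • f) = c • linPart G f := by
  simp only [linPart, classInner_smul_left, Finset.smul_sum, smul_smul]

/-- `linPart 0 = 0`. [folklore] -/
theorem linPart_zero : linPart G (0 : G → ℂ) = 0 := by
  simp only [linPart, classInner_zero_left, zero_smul, Finset.sum_const_zero]

/-- `linPart χ = χ` for `χ` linear. [folklore] -/
theorem linPart_of_mem_linF {χ : G → ℂ} (hχ : χ ∈ linF G) : linPart G χ = χ := by
  rw [linPart]
  have h : ∀ χ' ∈ linF G, classInner χ χ' • χ' = if χ = χ' then χ else 0 := fun χ' hχ' => by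
    rw [classInner_linF hχ hχ']
    split_ifs with h
    · rw [one_smul, h]
    · rw [zero_smul]
  rw [Finset.sum_congr rfl h, Finset.sum_ite_eq (linF G) χ, if_pos hχ]

/-- **`linPart` is the identity on the span of the linear characters.** [folklore] -/
theorem linPart_eq_self_of_mem_span {l : G → ℂ} (hl : l ∈ Submodule.span ℂ (linF G : Set (G → ℂ))) :
    linPart G l = l := by
  refine Submodule.span_induction (p := fun g _ => linPart G g = g) ?_ ?_ ?_ ?_ hl
  · exact fun _ hχ => linPart_of_mem_linF hχ
  · exact linPart_zero
  · intro g g' _ _ hg hg'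
    rw [linPart_add, hg, hg']
  · intro c g _ hg
    rw [linPart_smul, hg]

/-- `linPart f = 0` when `f ⊥ linF`. [folklore] -/
theorem linPart_eq_zero_of_orth {f : G → ℂ} (h : ∀ χ ∈ linF G, classInner f χ = 0) :
    linPart G f = 0 :=
  Finset.sum_eq_zero fun χ hχ => by rw [h χ hχ, zero_smul]

/-- `linPart j = 0` for `j ∈ J(G)`. [folklore] -/
theorem linPart_of_mem_afSpan {j : G → ℂ} (hj : j ∈ afSpan G) : linPart G j = 0 :=
  linPart_eq_zero_of_orth fun _ hχ => classInner_eq_zero_of_mem_afSpan hj hχ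


/-- `f - linPart f ∈ linOrth` for `f ∈ R(G)`. [folklore] -/
theorem sub_linPart_mem_linOrth {f : G → ℂ} (hf : f ∈ virtChars G) : f - linPart G f ∈ linOrth G :=
  ⟨Subring.sub_mem _ hf (linPart_mem_virtChars hf), fun _ hχ => classInner_sub_linPart f hχ⟩

/-- **`AFB⁰ ⇒ AFB¹`**: if `linOrth G ⊆ J(G)` then `f - linPart f ∈ J(G)` for every `f ∈ R(G)`. [folklore] -/
theorem sub_linPart_mem_afSpan (h : linOrth G ⊆ (afSpan G : Set (G → ℂ))) {f : G → ℂ}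
    (hf : f ∈ virtChars G) : f - linPart G f ∈ afSpan G :=
  h (sub_linPart_mem_linOrth hf)

/-! ### Frobenius values of permutation characters against linear characters -/

open scoped Classical in
/-- `⟨π_K, μ⟩ = [K ≤ ker μ]`. [folklore] -/
theorem classInner_indOne_coe (K : Subgroup G) (μ : G →* ℂˣ) :
    classInner (indOne K) (fun g => (μ g : ℂ)) = if K ≤ μ.ker then 1 else 0 := by
  classical
  rw [indOne, classInner_indClassFun_left K _ (isCharacter_coe_monoidHom' μ).isClassFun]
  have h1 : (fun _ : K => (1 : ℂ)) = fun x : K => ((1 : K →* ℂˣ) x : ℂ) := by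
    funext x; simp only [MonoidHom.one_apply, Units.val_one]
  have key := (isIrrChar_coe (1 : K →* ℂˣ)).classInner_eq (isIrrChar_coe (μ.restrict K))
  rw [← h1] at key
  rw [show (fun x : K => (μ (x : G) : ℂ)) = fun x : K => ((μ.restrict K) x : ℂ) from rfl, key]
  have hiff : ((fun _ : K => (1 : ℂ)) = fun x : K => ((μ.restrict K) x : ℂ)) ↔ K ≤ μ.ker := by
    constructor
    · intro h k hk
      have hk' := (congrFun h ⟨k, hk⟩).symm
      rw [MonoidHom.restrict_apply, Units.val_eq_one] at hk'
      exact hk'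
    · intro h
      funext x
      rw [MonoidHom.restrict_apply, (MonoidHom.mem_ker).mp (h x.2), Units.val_one]
  by_cases hK : K ≤ μ.ker
  · rw [if_pos (hiff.mpr hK), if_pos hK]
  · rw [if_neg (fun h => hK (hiff.mp h)), if_neg hK]

/-- `⟨f · μ, ν⟩ = ⟨f, ν μ⁻¹⟩`. [folklore] -/
theorem classInner_mul_coe (f : G → ℂ) (μ ν : G →* ℂˣ) :
    classInner (f * fun g => (μ g : ℂ)) (fun g => (ν g : ℂ)) =
      classInner f (fun g => ((ν * μ⁻¹) g : ℂ)) := by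
  simp only [classInner_apply, Pi.mul_apply, MonoidHom.mul_apply, MonoidHom.inv_apply, map_inv,
    inv_inv, Units.val_mul]
  congr 1
  exact Finset.sum_congr rfl fun s _ => by ring

omit [Fintype G] in
/-- Membership in `coverers`. [folklore] -/
theorem mem_coverers {K : Subgroup G} : K ∈ coverers G ↔ ∀ μ : G →* ℂˣ, K ≤ μ.ker → μ = 1 := Iff.rfl

omit [Fintype G] in
/-- `coverers` is upward closed. [folklore] -/
theorem mem_coverers_of_le {K K' : Subgroup G} (hK : K ∈ coverers G) (h : K ≤ K') : K' ∈ coverers G :=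
  fun μ hμ => hK μ (h.trans hμ)

omit [Fintype G] in
/-- `⊤` covers. [folklore] -/
theorem top_mem_coverers : (⊤ : Subgroup G) ∈ coverers G := fun μ hμ =>
  MonoidHom.ext fun g => by
    have := hμ (Subgroup.mem_top g)
    rw [MonoidHom.mem_ker] at this
    rw [this, MonoidHom.one_apply]

/-- For a covering `H₀`: `⟨π_{H₀} · μ, ν⟩ = [ν = μ]`. [folklore] -/
theorem classInner_indOne_mul_coe {H₀ : Subgroup G} (hH₀ : H₀ ∈ coverers G) (μ ν : G →* ℂˣ) :
    classInner (indOne H₀ * fun g => (μ g : ℂ)) (fun g => (ν g : ℂ)) = if ν = μ then 1 else 0 := by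
  classical
  rw [classInner_mul_coe, classInner_indOne_coe]
  by_cases h : ν = μ
  · subst h
    have hk : H₀ ≤ (ν * ν⁻¹).ker := fun g _ => by
      rw [MonoidHom.mem_ker, MonoidHom.mul_apply, MonoidHom.inv_apply, mul_inv_cancel]
    rw [if_pos rfl, if_pos hk]
  · rw [if_neg h, if_neg]
    intro hle
    exact h (mul_inv_eq_one.mp (hH₀ _ hle))

/-- For a covering `H₀` and `r` in the span of the linear characters: `linPart (π_{H₀} · r) = r`. [folklore] -/
theorem linPart_indOne_mul {H₀ : Subgroup G} (hH₀ : H₀ ∈ coverers G) {r : G → ℂ}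
    (hr : r ∈ Submodule.span ℂ (linF G : Set (G → ℂ))) : linPart G (indOne H₀ * r) = r := by
  classical
  refine Submodule.span_induction (p := fun g _ => linPart G (indOne H₀ * g) = g) ?_ ?_ ?_ ?_ hr
  · intro χ hχ
    obtain ⟨μ, rfl⟩ := exists_hom_of_mem_linF hχ
    rw [linPart]
    have h : ∀ χ' ∈ linF G, classInner (indOne H₀ * fun g => (μ g : ℂ)) χ' • χ' =
        if (fun g => (μ g : ℂ)) = χ' then (fun g => (μ g : ℂ)) else 0 := fun χ' hχ' => by
      obtain ⟨ν, rfl⟩ := exists_hom_of_mem_linF hχ'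
      rw [classInner_indOne_mul_coe hH₀]
      by_cases hνμ : ν = μ
      · subst hνμ; rw [if_pos rfl, one_smul, if_pos rfl]
      · rw [if_neg hνμ, zero_smul, if_neg (fun h => hνμ (coe_injective' h).symm)]
    rw [Finset.sum_congr rfl h, Finset.sum_ite_eq (linF G), if_pos (coe_mem_linF μ)]
  · rw [mul_zero, linPart_zero]
  · intro g g' _ _ hg hg'
    rw [mul_add, linPart_add, hg, hg']
  · intro c g _ hg
    rw [mul_smul_comm, linPart_smul, hg]

/-- For a covering `H₀`: `π_{H₀} - 1 ⊥ linF`. [folklore] -/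
theorem classInner_indOne_sub_one {H₀ : Subgroup G} (hH₀ : H₀ ∈ coverers G) {χ : G → ℂ}
    (hχ : χ ∈ linF G) :
    classInner (indOne H₀ - 1) χ = 0 := by
  classical
  obtain ⟨μ, rfl⟩ := exists_hom_of_mem_linF hχ
  have h1 := classInner_indOne_coe H₀ μ
  have h2 := classInner_indOne_coe (⊤ : Subgroup G) μ
  rw [indOne_top] at h2
  rw [sub_eq_add_neg, classInner_add_left, ← neg_one_smul ℂ (1 : G → ℂ), classInner_smul_left, h1, h2]
  by_cases hμ : μ = 1
  · subst hμ
    have hk : ∀ K : Subgroup G, K ≤ (1 : G →* ℂˣ).ker := fun K => by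
      rw [MonoidHom.ker_one]
      exact le_top
    rw [if_pos (hk H₀), if_pos (hk ⊤)]
    ring
  · rw [if_neg (fun h => hμ (hH₀ μ h)), if_neg (fun h => hμ (top_mem_coverers μ h))]
    ring

/-! ### The hull `⋂ {ker μ | K ≤ ker μ}` ("`KG'`") -/

omit [Fintype G] in
/-- `K ≤ hull K`. [folklore] -/
theorem le_hull (K : Subgroup G) : K ≤ hull G K :=
  le_iInf fun _ => le_iInf fun h => h

omit [Fintype G] in
/-- `hull K ≤ ker μ` whenever `K ≤ ker μ`. [folklore] -/
theorem hull_le_ker {K : Subgroup G} {μ : G →* ℂˣ} (h : K ≤ μ.ker) : hull G K ≤ μ.ker :=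
  (iInf_le _ μ).trans (iInf_le _ h)

omit [Fintype G] in
/-- `hull K` is normal. [folklore] -/
theorem hull_normal (K : Subgroup G) : (hull G K).Normal := by
  refine ⟨fun g hg x => ?_⟩
  rw [hull, Subgroup.mem_iInf] at hg ⊢
  intro μ
  rw [Subgroup.mem_iInf] at *
  intro h
  have hg' := (Subgroup.mem_iInf.mp (hg μ)) h
  rw [MonoidHom.mem_ker] at hg' ⊢
  rw [map_mul, map_mul, hg', mul_one, ← map_mul, mul_inv_cancel, map_one]

omit [Fintype G] in
/-- `commutator G ≤ hull K`, so `G / hull K` is commutative. [folklore] -/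
theorem commutator_le_hull (K : Subgroup G) : commutator G ≤ hull G K :=
  le_iInf fun μ => le_iInf fun _ => Abelianization.commutator_subset_ker μ

omit [Fintype G] in
/-- `hull K = ⊤ ↔ K` covers. [folklore] -/
theorem hull_eq_top_iff (K : Subgroup G) : hull G K = ⊤ ↔ K ∈ coverers G := by
  constructor
  · intro h μ hμ
    have hle : hull G K ≤ μ.ker := hull_le_ker hμ
    rw [h, top_le_iff, MonoidHom.ker_eq_top_iff] at hle
    exact hle
  · intro h
    refine top_le_iff.mp (le_iInf fun μ => le_iInf fun hμ => ?_)
    rw [h μ hμ, MonoidHom.ker_one]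

omit [Fintype G] in
/-- The defining property of the hull: a linear character trivial on `K` is trivial on `hull K`. [folklore] -/
theorem hull_absorbs (K : Subgroup G) (μ : G →* ℂˣ) (h : K ≤ μ.ker) : hull G K ≤ μ.ker :=
  hull_le_ker h

end Linear

end Summit.Langlands.Langlands.Theorems.AbelianFreeBrauer

end
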